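import Literature.Computability.FineGrained.KOVReductionProgram
import Literature.Computability.FineGrained.KOVFromSETH
import Literature.Computability.FineGrained.OVFromSETHSplitInstance
import Literature.Computability.FineGrained.CliqueETHGroupingReduction
import HarnessLib

/-!
# SETH ⇒ `k`-OV: the split-and-list reduction on the word RAM (proof of the named fact)

The proof of the named fact `sparseKSATInRAMTime_of_kOV_inTimeO` of `…FineGrained.KOVFromSETH`
(V. Vassilevska Williams, ICM 2018, §3, Thm. 3.1 and its proof, after R. Williams, TCS 348 (2005),
§5.1, read on the word RAM): if for some `k ≥ 2`, some `0 < ε ≤ 1` and every `c ≥ 1` `k`-OV in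
dimension `c ⌊log₂ n⌋` (`kOVWithDim k c`) has a deterministic `O(n^{k-ε})`-time word-RAM algorithm,
then for every width `k'`, density `c'` and `δ > 1 - ε/k` the sparse `k'`-CNFs are decided in
word-RAM time `O(2^{δ n})` (`SparseKSATInRAMTime k' c' δ`). With the build of
`…KOVReductionProgram` in hand, this file supplies

* **the run** (`Params.reduction_outputsWithin`): the emulator's side conditions for the reduction's
  layout (`Params.envOK`), the target invariant and the agreement of the emulated memory with the
  initial memory of the `k`-OV program on the split instance at the end of the build
  (`Params.tinv_finMem`, `Params.agree_finMem`), the read-out (`Params.post_spec`), whence, by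
  `SProg.outputsWithin_withSubrun`, the reduction program outputs the `k`-OV program's answer bit —
  `[1]` iff `φ` is satisfiable, by `hasOrthogonalTuple_splitInstance_iff` — within
  `Tpre + 38 T + 4` steps;
* **the word size** (`Params.fits`): at `W = kfit · (n + inputWidth x)` (`Params.kfit` of the
  program file) everything fits;
* **the time** (`Params.Tpre_le`, `Params.Tpre_real_le`, `Params.rpow_N_le`): the build is
  `O(N (n+1)²) = O(2^{δ n})` for `δ > 1/k`, and the emulated run costs
  `38 ⌊C N^{k-ε} + C⌋ = O(2^{(1-ε/k) n})`;
* **the named fact** `sparseKSATInRAMTime_of_kOV_inTimeO_holds`, and with it the reduction of the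
  target `not_kOVWithDim_inTimeO_of_sethWordRAM` to word-RAM sparsification alone
  (`not_kOVWithDim_inTimeO_of_sethWordRAM_of_serf`).

## References

* V. Vassilevska Williams, *On some fine-grained questions in algorithms and complexity*,
  Proc. ICM 2018, §2 (word RAM), §3 Thm. 3.1 (proof).
* R. Williams, *A new algorithm for optimal 2-constraint satisfaction and its implications*,
  Theoret. Comput. Sci. 348 (2005), §5.1.
-/


namespace Literature.Computability.FineGrained

open Cryptography Cryptography.WordRAM Complexity Cryptography.WordRAM.SProg
open CliqueRed (r pt im lay mem_one_of_readOut relocated_le_of_forall)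

namespace KOVRed

namespace Params

variable (g : Params) {W : ℕ} {O : List ℕ → List ℕ}

/-! ### The run -/

/-- The emulator's side conditions hold for the reduction's layout and environment. [folklore] -/
theorem envOK (hF : g.Fits W) (hk : 1 ≤ g.k) (hc : 1 ≤ g.c) : EnvOK lay g.env W := by
  obtain ⟨hX, hXLx, hBv, hSv, htop, hLyV, hPwV, hcMV, hmLx, hN2, hd1, hNNd, hdNd, hNdk, hLy, hNd,
    hNG, hdc, hPw1, hG1, hGN, hGdef, hk1⟩ := g.facts hF hk hc
  refine ⟨by decide, by decide, by decide, by decide, by decide, by decide, by decide,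
    fun r hr => ?_, Or.inl ?_, ?_, ?_, hF.ws_lt.le⟩
  · simp only [lay, CliqueRed.lay, Layout.regs, List.mem_cons, List.not_mem_nil, or_false] at hr
    show r < g.Bv ∧ r < g.Sv
    rcases hr with rfl | rfl | rfl | rfl | rfl | rfl | rfl <;> omega
  · show g.Bv + (g.V + 1) ≤ g.Sv; omega
  · show g.Bv + (g.V + 1) ≤ 2 ^ W; omega
  · show g.Sv + (g.V + 1) ≤ 2 ^ W; omega

/-- Every cell of the final memory is below `2 ^ W`. [folklore] -/
theorem finMem_lt (hF : g.Fits W) (hk : 1 ≤ g.k) (hc : 1 ≤ g.c) (a : ℕ) : g.finMem a < 2 ^ W := by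
  obtain ⟨hX, hXLx, hBv, hSv, htop, hLyV, hPwV, hcMV, hmLx, hN2, hd1, hNNd, hdNd, hNdk, hLy, hNd,
    hNG, hdc, hPw1, hG1, hGN, hGdef, hk1⟩ := g.facts hF hk hc
  unfold finMem
  by_cases ha : a < 100
  · rw [if_pos ha]; split_ifs <;> omega
  rw [if_neg ha]
  unfold finData
  split_ifs
  · exact lt_of_le_of_lt (relocated_le_of_forall (B := 2 ^ W - 1)
      (fun v hv => Nat.le_sub_one_of_lt (hF.input v hv)) (by omega)) (by omega)
  · have : g.ycell (a - g.Bv) < g.Pw := by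
      unfold ycell; split_ifs <;> exact Nat.mod_lt _ (Nat.two_pow_pos _)
    omega
  · exact Nat.two_pow_pos W

/-- **The target invariant at the end of the build.** [folklore] -/
theorem tinv_finMem (hF : g.Fits W) (hk : 1 ≤ g.k) (hc : 1 ≤ g.c) :
    TInv lay g.env (2 ^ W - 1) g.finMem := by
  obtain ⟨hX, hXLx, hBv, hSv, htop, hLyV, hPwV, hcMV, hmLx, hN2, hd1, hNNd, hdNd, hNdk, hLy, hNd,
    hNG, hdc, hPw1, hG1, hGN, hGdef, hk1⟩ := g.facts hF hk hc
  refine ⟨⟨?_, ?_, ?_, ?_⟩, fun a _ => ?_, fun a => Nat.le_sub_one_of_lt (g.finMem_lt hF hk hc a)⟩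
  · show g.finMem 10 = g.Bv; simp [finMem]
  · show g.finMem 11 = g.Sv; simp [finMem]
  · show g.finMem 12 = 0; simp [finMem]
  · show g.finMem 13 = 2 ^ g.ws; simp [finMem]; rfl
  · show g.finMem (g.Sv + a) ≤ 0
    unfold finMem finData
    rw [if_neg (by omega), if_neg (by omega), if_neg (by omega)]

/-- **The emulated input is in place at the end of the build**: below the region size, the
emulated memory is the initial memory of the `k`-OV program on `y` at word size `ws`. [folklore] -/
theorem agree_finMem (hF : g.Fits W) (hk : 1 ≤ g.k) (hc : 1 ≤ g.c) :
    Agree g.env g.finMem (init g.ws g.y).mem := by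
  obtain ⟨hX, hXLx, hBv, hSv, htop, hLyV, hPwV, hcMV, hmLx, hN2, hd1, hNNd, hdNd, hNdk, hLy, hNd,
    hNG, hdc, hPw1, hG1, hGN, hGdef, hk1⟩ := g.facts hF hk hc
  have hlen : g.y.length = g.Ly := g.length_y
  intro a _
  have hstamp : g.finMem (g.Sv + a) = 0 := by
    unfold finMem finData
    rw [if_neg (by omega), if_neg (by omega), if_neg (by omega)]
  show (if g.finMem (g.Sv + a) = 0 then g.finMem (g.Bv + a) else 0) = (init g.ws g.y).mem a
  rw [if_pos hstamp]
  unfold finMem finData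
  rw [if_neg (by omega), if_neg (by omega), Nat.add_sub_cancel_left]
  rcases Nat.lt_or_ge a (g.Ly + 1) with ha | ha
  · rw [if_pos (by omega)]
    unfold ycell
    rcases Nat.eq_zero_or_pos a with rfl | hpos
    · rw [if_pos rfl, init_mem_zero, hlen]; rfl
    · obtain ⟨j, rfl⟩ := Nat.exists_eq_add_of_le' hpos
      rw [if_neg (by omega), Nat.add_sub_cancel, init_mem_succ _ _ _ (by omega),
        List.getD_eq_getElem _ _ (by omega)]; rfl
  · rw [if_neg (by omega), init_mem_of_length_lt _ _ _ (by omega)]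

/-- **The read-out.** From any memory agreeing with the halting memory `dm` of the `k`-OV program
(target invariant kept), `post` outputs `[dm 1]` in `3` steps. [folklore] -/
theorem post_spec (hF : g.Fits W) (hk : 1 ≤ g.k) (hc : 1 ≤ g.c) {m₂ dm : ℕ → ℕ}
    (hag : Agree g.env m₂ dm) (hI : TInv lay g.env (2 ^ W - 1) m₂) (qs : List (List ℕ)) :
    ∃ (st₃ : Store) (t₃ : ℕ), t₃ ≤ 3 ∧ Exec W O CliqueRed.post ⟨m₂, qs⟩ st₃ t₃ ∧
      readOut st₃.mem = [dm 1] := by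
  obtain ⟨hX, hXLx, hBv, hSv, htop, hLyV, hPwV, hcMV, hmLx, hN2, hd1, hNNd, hdNd, hNdk, hLy, hNd,
    hNG, hdc, hPw1, hG1, hGN, hGdef, hk1⟩ := g.facts hF hk hc
  have h10 : m₂ 10 = g.Bv := hI.env.1
  have hst : m₂ (g.Sv + 1) = 0 := Nat.le_zero.1 (hI.stamp 1 (by show 1 < g.V + 1; omega))
  have h1 : m₂ (g.Bv + 1) = dm 1 := by
    have := hag 1 (by show 1 < g.V + 1; omega)
    simp only [edec, Params.env, hst, if_true] at this
    exact this
  refine ⟨_, 3, le_rfl, Exec.block _ m₂ qs, ?_⟩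
  have hm : execOps W m₂ [(.add, r 17, r 10, im 1), (.band, r 1, pt 17, pt 17), (.band, r 0, im 1,
    im 1)] =
      Function.update (Function.update (Function.update m₂ 17 (g.Bv + 1)) 1 (dm 1)) 0 1 := by
    simp (disch := first | omega | decide) only [execOps_cons, execOps_nil, execOp, Operand.write,
      Operand.read, Function.update_self, Function.update_of_ne, h10, BinOp.eval_add_of_lt,
      BinOp.eval_band, Nat.and_self]
    rw [h1]
  show readOut (execOps W m₂ _) = _
  rw [hm]
  simp [readOut, readSeg, Function.update_self, Function.update_of_ne]

/-- **The reduction program's output.** At a word size `W` with `g.Fits W` (`k ≥ 1`, `c ≥ 1`,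
width `≤ kw`, `m ≤ d`), if the deterministic oracle-free `k`-OV program `M` (largest constant `cM`)
outputs `[bit]` on the split instance `y` at word size `ws = kM · width` within `T` steps, then the
reduction program outputs `[bit]` on `x = encodeCNFWords φ` within `Tpre + 38 T + 4` steps.
[folklore] -/
theorem reduction_outputsWithin (hF : g.Fits W) (hk : 1 ≤ g.k) (hc : 1 ≤ g.c) {kw : ℕ}
    (hw : g.φ.IsWidthLE kw) (hmd : g.m ≤ g.d) {M : Program} (hdet : M.IsDeterministic)
    (hof : M.IsOracleFree) (hcM : M.maxConst = g.cM) {T bit : ℕ}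
    (hM : OutputsWithin M g.ws noOracle zeroCoins g.y [bit] T) :
    OutputsWithin (withSubrun (pre g.k g.c g.kM g.cM) lay M CliqueRed.post) W noOracle zeroCoins g.x
      [bit] (g.Ttotal kw T) := by
  obtain ⟨hX, hXLx, hBv, hSv, htop, hLyV, hPwV, hcMV, hmLx, hN2, hd1, hNNd, hdNd, hNdk, hLy, hNd,
    hNG, hdc, hPw1, hG1, hGN, hGdef, hk1⟩ := g.facts hF hk hc
  have hW1 : 1 ≤ W := by have := hF.ws_lt; omega
  have h2W : 2 ≤ 2 ^ W := by
    calc (2 : ℕ) = 2 ^ 1 := rfl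
      _ ≤ 2 ^ W := Nat.pow_le_pow_right (by norm_num) hW1
  obtain ⟨st₁, t₁, ht₁, hexec, hmem, hqs⟩ :=
    (g.pre_spec (O := noOracle) hF hk hc hw hmd).exists_exec
  obtain ⟨dh, hhalt, hout⟩ := (outputsWithin_iff_exists_haltsWithin _ _ _ _ _ _ _).1 hM
  have hst₁ : st₁ = ⟨g.finMem, []⟩ := by cases st₁; simp only at hmem hqs; rw [hmem, hqs]
  subst hst₁
  have key := outputsWithin_withSubrun (O := noOracle) zeroCoins (pre := pre g.k g.c g.kM g.cM)
    (post := CliqueRed.post) (L := lay) (E := g.env) (VT := 2 ^ W - 1) (V := g.V) (M := M)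
    (x := g.x) (y := g.y) (out := [bit]) (T₂ := 3) hF.width hexec (g.envOK hF hk hc) (by omega)
    (by omega)
    (fun r hr => by
      simp only [lay, CliqueRed.lay, Layout.regs, List.mem_cons, List.not_mem_nil, or_false] at hr
      rcases hr with rfl | rfl | rfl | rfl | rfl | rfl | rfl <;> omega)
    hdet hof (by rw [hcM]; exact hcMV) (by show g.V < g.V + 1; omega) (by omega)
    (by show 2 ^ g.ws - 1 ≤ g.V; have := g.le_V; unfold Pw at this; omega) (by omega)
    (g.tinv_finMem hF hk hc) (g.agree_finMem hF hk hc) hhalt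
    (fun m₂ hag hI _ => by
      have := g.post_spec (O := noOracle) hF hk hc hag hI []
      rwa [mem_one_of_readOut hout] at this)
  exact key.mono (by unfold Ttotal; omega)

/-! ### The running time of the build -/

/-- **The running time of the build**: `Tpre ≤ 196 · c k · N · (kw + 1)(m + 1) · (n + 1)` (the input
length is `Lx = 2 + m + size ≤ 2 + (kw + 1) m` for width `≤ kw`, cf. `ETHBridge.size_le_of_isWidthLE`).
[folklore] -/
theorem Tpre_le (hk : 1 ≤ g.k) (hc : 1 ≤ g.c) {kw : ℕ} (hw : g.φ.IsWidthLE kw) :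
    g.Tpre kw ≤ 196 * (g.c * g.k * g.N * ((kw + 1) * (g.m + 1)) * (g.n + 1)) := by
  set P := (kw + 1) * (g.m + 1) with hP
  set B := g.c * g.k * g.N * P * (g.n + 1) with hB
  have hN : 1 ≤ g.N := le_trans (by norm_num) g.two_le_N
  have hP1 : 1 ≤ P := Nat.one_le_iff_ne_zero.2 (Nat.mul_ne_zero (by omega) (by omega))
  have hLx : g.Lx ≤ 2 + P := by
    -- `size φ ≤ kw · m` for width `≤ kw`, hence `Lx = 2 + m + size ≤ 2 + (kw + 1) m ≤ 2 + P`
    have hsize : ∀ ψ : CNF ℕ, ψ.IsWidthLE kw → CNF.size ψ ≤ kw * ψ.length := by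
      intro ψ hψ
      unfold CNF.size
      induction ψ with
      | nil => simp
      | cons cl ψ ih =>
        simp only [List.map_cons, List.sum_cons, List.length_cons]
        have h1 := hψ cl (by simp)
        have h2 := ih (fun d hd => hψ d (by simp [hd]))
        nlinarith
    have h := hsize g.φ hw
    have hLx' : g.Lx = 2 + g.m + CNF.size g.φ := by
      unfold Lx x m; rw [length_encodeCNFWords_eq, CNF.numClauses]
    have : (kw + 1) * g.m ≤ P := Nat.mul_le_mul_left _ (Nat.le_succ _)
    have hm : g.φ.length = g.m := rfl
    rw [hm] at h
    nlinarith
  have hsz : Nat.size g.Ly ≤ g.Ly := CliqueRed.size_le_self _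
  have hG : g.G ≤ g.n + 1 := Nat.succ_le_succ (Nat.div_le_self _ _)
  -- the four summands against `B`
  have h1 : P ≤ B := by
    calc P = 1 * 1 * 1 * P * 1 := by ring
      _ ≤ g.c * g.k * g.N * P * (g.n + 1) := by gcongr; all_goals omega
  have h2 : g.Ly ≤ 3 * B := by
    have : g.Nd * g.k ≤ B := by
      calc g.Nd * g.k = g.c * g.k * g.N * 1 * g.G := by unfold Nd d; ring
        _ ≤ g.c * g.k * g.N * P * (g.n + 1) := by gcongr
    unfold Ly; omega
  have h3 : g.Tfill kw ≤ 25 * B + 3 := by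
    have hrow : g.Trow kw + 2 ≤ 18 * P := by
      unfold Trow Tcl; rw [hP]; nlinarith
    have hlist : g.Tlist kw + 2 ≤ 25 * (g.N * P) := by
      unfold Tlist
      have := Nat.mul_le_mul_left g.N hrow
      have hNP : 1 ≤ g.N * P := Nat.one_le_iff_ne_zero.2 (Nat.mul_ne_zero (by omega) (by omega))
      nlinarith
    have hB' : g.k * (g.N * P) ≤ B := by
      calc g.k * (g.N * P) = 1 * g.k * g.N * P * 1 := by ring
        _ ≤ g.c * g.k * g.N * P * (g.n + 1) := by gcongr; all_goals omega
    unfold Tfill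
    have := Nat.mul_le_mul_left g.k hlist
    nlinarith
  have hB1 : 1 ≤ B := le_trans hP1 h1
  unfold Tpre
  omega

/-! ### The word size -/

/-- **The word size fits.** For `k, c ≥ 1`, the run at word size `kfit · (n + inputWidth x)`
satisfies `Fits`. [folklore] -/
theorem fits (hk : 1 ≤ g.k) (hc : 1 ≤ g.c) :
    g.Fits (kfit g.k g.c g.kM g.cM * (g.n + inputWidth g.x)) := by
  -- notation
  set n := g.n with hn
  set w := inputWidth g.x with hw
  set A := 2 * g.c * g.k + 2 * g.cM + 111 with hA
  set s₀ := Nat.size (g.c * g.k + 2) with hs₀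
  have hw1 : 1 ≤ w := inputWidth_pos _
  have hLx : g.Lx < 2 ^ w := length_lt_two_pow_inputWidth _
  have hnw : n < 2 ^ w := by
    have h := lt_two_pow_inputWidth_of_mem g.x (g.x.getD 0 0) (by
      rw [List.getD_eq_getElem _ _ (by have := g.two_le_Lx; unfold Lx at this; omega)]
      exact List.getElem_mem _)
    rwa [x_getD_zero] at h
  obtain ⟨hX, hBv, hSv⟩ := g.bases
  -- G, N, d, Nd, Ly
  have hG : g.G ≤ n + 1 := Nat.succ_le_succ (Nat.div_le_self _ _)
  have hN : g.N ≤ 2 ^ (n + 1) := Nat.pow_le_pow_right Nat.two_pos hG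
  have hd : g.d ≤ g.c * 2 ^ w := by
    unfold d; exact Nat.mul_le_mul_left _ (hG.trans (by omega))
  set E₁ := n + 1 + w with hE₁
  have hNd : g.Nd ≤ g.c * 2 ^ E₁ := by
    unfold Nd
    calc g.N * g.d ≤ 2 ^ (n + 1) * (g.c * 2 ^ w) := Nat.mul_le_mul hN hd
      _ = g.c * 2 ^ E₁ := by rw [hE₁, Nat.pow_add]; ring
  have hLy : g.Ly ≤ (g.c * g.k + 2) * 2 ^ E₁ := by
    have h1 : g.Nd * g.k ≤ g.c * g.k * 2 ^ E₁ := by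
      calc g.Nd * g.k ≤ g.c * 2 ^ E₁ * g.k := Nat.mul_le_mul_right _ hNd
        _ = g.c * g.k * 2 ^ E₁ := by ring
    unfold Ly
    exact CliqueRed.add_le_mul_two_pow h1 (by have := Nat.one_le_two_pow (n := E₁); omega)
  -- size, ws
  have hσ : Nat.size g.Ly ≤ s₀ + E₁ := by
    have := Nat.size_le_size hLy
    rwa [← Nat.shiftLeft_eq, Nat.size_shiftLeft (by positivity)] at this
  have hws : g.ws ≤ g.kM * s₀ + g.kM * E₁ := by
    have : g.ws ≤ g.kM * (s₀ + E₁) := Nat.mul_le_mul_left _ hσ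
    rw [Nat.mul_add] at this; exact this
  -- the exponent
  set E := g.ws + E₁ with hE
  have h2E : ∀ t, t ≤ E → 2 ^ t ≤ 2 ^ E := fun t ht => Nat.pow_le_pow_right Nat.two_pos ht
  have hV : g.V ≤ 2 ^ g.ws + g.cM + g.Ly := by
    unfold V Pw; have := Nat.one_le_two_pow (n := g.ws); omega
  have hBvle : g.Bv ≤ 103 * 2 ^ E := by
    have e1 : 2 * g.Lx ≤ 2 * 2 ^ E := by have := h2E w (by omega); omega
    have e2 : 101 ≤ 101 * 2 ^ E := CliqueRed.le_self_mul_two_pow _ _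
    have : g.Bv = 2 * g.Lx + 101 := by rw [← hBv]; unfold X; ring
    rw [this, show (103 : ℕ) = 2 + 101 by rfl]
    exact CliqueRed.add_le_mul_two_pow e1 e2
  have hVle : 2 * g.V + 2 ≤ (2 * (g.c * g.k) + 2 * g.cM + 8) * 2 ^ E := by
    have e1 : 2 * 2 ^ g.ws ≤ 2 * 2 ^ E := Nat.mul_le_mul_left _ (h2E _ (by omega))
    have e2 : 2 * g.cM ≤ 2 * g.cM * 2 ^ E := CliqueRed.le_self_mul_two_pow _ _
    have e3 : 2 * g.Ly ≤ 2 * (g.c * g.k + 2) * 2 ^ E := by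
      rw [Nat.mul_assoc]
      exact Nat.mul_le_mul_left _ (hLy.trans (Nat.mul_le_mul_left _ (h2E _ (by omega))))
    have e4 : 2 ≤ 2 * 2 ^ E := CliqueRed.le_self_mul_two_pow _ _
    have h := CliqueRed.add_le_mul_two_pow (CliqueRed.add_le_mul_two_pow
      (CliqueRed.add_le_mul_two_pow e1 e2) e3) e4
    rw [show 2 + 2 * g.cM + 2 * (g.c * g.k + 2) + 2 = 2 * (g.c * g.k) + 2 * g.cM + 8 by ring] at h
    omega
  have htot : g.Sv + g.V + 1 ≤ 2 ^ (Nat.size A + E) := by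
    have h := CliqueRed.add_le_mul_two_pow hBvle hVle
    rw [show 103 + (2 * (g.c * g.k) + 2 * g.cM + 8) = A by rw [hA]; ring] at h
    exact le_trans (by omega) (h.trans (CliqueRed.mul_two_pow_le_two_pow_size_add A E))
  -- the word size
  set sA := Nat.size A with hsA
  have hkfit : kfit g.k g.c g.kM g.cM = sA + g.kM * s₀ + 2 * g.kM + 3 := by
    rw [kfit, hsA, hA, hs₀]
  have hW : sA + E + 1 ≤ kfit g.k g.c g.kM g.cM * (n + w) := by
    rw [hkfit, hE, hE₁]
    have h1 : sA ≤ sA * (n + w) := Nat.le_mul_of_pos_right _ (by omega)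
    have h2 : g.kM * s₀ ≤ g.kM * s₀ * (n + w) := Nat.le_mul_of_pos_right _ (by omega)
    have h3 : g.kM * (n + 1 + w) ≤ 2 * g.kM * (n + w) :=
      calc g.kM * (n + 1 + w) ≤ g.kM * (2 * (n + w)) := Nat.mul_le_mul_left _ (by omega)
        _ = 2 * g.kM * (n + w) := by ring
    have h4 : n + 1 + w + 1 ≤ 3 * (n + w) := by omega
    have h5 : g.kM * E₁ = g.kM * (n + 1 + w) := by rw [hE₁]
    calc sA + (g.ws + (n + 1 + w)) + 1 ≤ sA + (g.kM * s₀ + g.kM * (n + 1 + w)) + (n + 1 + w + 1) := by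
          rw [← h5]; omega
      _ ≤ sA * (n + w) + g.kM * s₀ * (n + w) + 2 * g.kM * (n + w) + 3 * (n + w) := by omega
      _ = (sA + g.kM * s₀ + 2 * g.kM + 3) * (n + w) := by ring
  refine ⟨htot.trans (Nat.pow_le_pow_right Nat.two_pos (by omega)), by omega, ?_⟩
  calc w ≤ 1 * (n + w) := by omega
    _ ≤ kfit g.k g.c g.kM g.cM * (n + w) := Nat.mul_le_mul_right _ (by rw [hkfit]; omega)

/-! ### The time in real terms -/

/-- **The build in real terms**: for `m ≤ c' n`, width `≤ kw` and a polynomial-vs-exponential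
constant `C₃` of exponent `η`, `Tpre ≤ 392 c k (kw+1)(c'+1) C₃ · 2^{n/k} · 2^{η n}`. [folklore] -/
theorem Tpre_real_le (hk : 1 ≤ g.k) (hc : 1 ≤ g.c) {kw : ℕ} (hw : g.φ.IsWidthLE kw) {c' : ℕ}
    (hm : g.m ≤ c' * g.n) {η : ℝ} {C₃ : ℝ}
    (hpoly : ∀ n : ℕ, ((n : ℝ) + 1) ^ 2 ≤ C₃ * (2 : ℝ) ^ (η * n)) :
    (g.Tpre kw : ℝ) ≤ 392 * ((g.c : ℝ) * g.k * (kw + 1) * (c' + 1)) * C₃ *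
      ((2 : ℝ) ^ ((g.n : ℝ) / g.k) * (2 : ℝ) ^ (η * g.n)) := by
  set n := g.n
  have hn0 : (0 : ℝ) ≤ n := Nat.cast_nonneg _
  have hT := g.Tpre_le hk hc hw
  have hN : (g.N : ℝ) ≤ 2 * (2 : ℝ) ^ ((n : ℝ) / g.k) := by
    rw [g.N_eq]; exact splitInstance_n_real_le g.φ g.k g.c
  have cT : (g.Tpre kw : ℝ) ≤
      196 * ((g.c : ℝ) * g.k * g.N * (((kw : ℝ) + 1) * ((g.m : ℝ) + 1)) * ((n : ℝ) + 1)) := by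
    have : ((g.Tpre kw : ℕ) : ℝ) ≤
        ((196 * (g.c * g.k * g.N * ((kw + 1) * (g.m + 1)) * (g.n + 1)) : ℕ) : ℝ) := by
      exact_mod_cast hT
    push_cast at this; exact this
  have hm1 : (g.m : ℝ) + 1 ≤ ((c' : ℝ) + 1) * ((n : ℝ) + 1) := by
    have : ((g.m : ℕ) : ℝ) ≤ ((c' * g.n : ℕ) : ℝ) := by exact_mod_cast hm
    push_cast at this
    nlinarith [hn0, Nat.cast_nonneg (α := ℝ) c']
  have hsq := hpoly n
  have hck : (0 : ℝ) ≤ (g.c : ℝ) * g.k * ((kw : ℝ) + 1) := by positivity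
  have e1 : (0 : ℝ) ≤ (2 : ℝ) ^ ((n : ℝ) / g.k) := by positivity
  calc (g.Tpre kw : ℝ)
      ≤ 196 * ((g.c : ℝ) * g.k * g.N * (((kw : ℝ) + 1) * ((g.m : ℝ) + 1)) * ((n : ℝ) + 1)) := cT
    _ = 196 * ((g.c : ℝ) * g.k * ((kw : ℝ) + 1)) * g.N * (((g.m : ℝ) + 1) * ((n : ℝ) + 1)) := by ring
    _ ≤ 196 * ((g.c : ℝ) * g.k * ((kw : ℝ) + 1)) * (2 * (2 : ℝ) ^ ((n : ℝ) / g.k)) *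
          ((((c' : ℝ) + 1) * ((n : ℝ) + 1)) * ((n : ℝ) + 1)) := by gcongr
    _ = 392 * ((g.c : ℝ) * g.k * (kw + 1) * (c' + 1)) * (2 : ℝ) ^ ((n : ℝ) / g.k) *
          ((n : ℝ) + 1) ^ 2 := by ring
    _ ≤ 392 * ((g.c : ℝ) * g.k * (kw + 1) * (c' + 1)) * (2 : ℝ) ^ ((n : ℝ) / g.k) *
          (C₃ * (2 : ℝ) ^ (η * n)) := by gcongr
    _ = _ := by ring

/-- **The emulated run in real terms**: `N^{k-ε} ≤ 2^k · 2^{(1-ε/k) n}` for `0 ≤ ε ≤ k`. [folklore] -/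
theorem rpow_N_le (hk : 1 ≤ g.k) {ε : ℝ} (hε0 : 0 ≤ ε) (hεk : ε ≤ g.k) :
    (g.N : ℝ) ^ ((g.k : ℝ) - ε) ≤ (2 : ℝ) ^ (g.k : ℝ) * (2 : ℝ) ^ ((1 - ε / g.k) * g.n) := by
  have hk0 : (0 : ℝ) < g.k := by exact_mod_cast hk
  have hG : (g.G : ℝ) ≤ (g.n : ℝ) / g.k + 1 := grpLen_real_le g.n g.k
  have hN : (g.N : ℝ) = (2 : ℝ) ^ (g.G : ℝ) := by unfold N; push_cast; rw [Real.rpow_natCast]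
  rw [hN, ← Real.rpow_mul (by norm_num), ← Real.rpow_add (by norm_num)]
  apply Real.rpow_le_rpow_of_exponent_le one_le_two
  have hke : 0 ≤ (g.k : ℝ) - ε := by linarith
  have hid : ((g.n : ℝ) / g.k + 1) * ((g.k : ℝ) - ε) = (1 - ε / g.k) * g.n + ((g.k : ℝ) - ε) := by
    have hk' : (g.k : ℝ) ≠ 0 := hk0.ne'
    field_simp
  calc (g.G : ℝ) * ((g.k : ℝ) - ε) ≤ ((g.n : ℝ) / g.k + 1) * ((g.k : ℝ) - ε) :=
        mul_le_mul_of_nonneg_right hG hke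
    _ = (1 - ε / g.k) * g.n + ((g.k : ℝ) - ε) := hid
    _ ≤ (g.k : ℝ) + (1 - ε / g.k) * g.n := by linarith

end Params

/-- A natural-number floor is at most the positive part. [folklore] -/
theorem natFloor_le_max (x : ℝ) : (⌊x⌋₊ : ℝ) ≤ max x 0 := by
  rcases le_or_gt 0 x with hx | hx
  · exact (Nat.floor_le hx).trans (le_max_left _ _)
  · rw [Nat.floor_of_nonpos hx.le]; simp

end KOVRed

/-! ### The named fact -/

/-- **The `k`-way split-and-list reduction on the word RAM (proof of the named fact
`sparseKSATInRAMTime_of_kOV_inTimeO`; VVW ICM 2018, §3, Thm. 3.1 and its proof, after Williams,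
TCS 348 (2005), §5.1).** Given `k ≥ 2`, `0 < ε ≤ 1` and `O(n^{k-ε})` word-RAM programs for
`kOVWithDim k c`, every `c ≥ 1`: for a width `k'`, a density `c'` and `δ > 1 - ε/k`, take
`c = c' k + 1` and the program for this `c`; run the reduction program (`KOVRed.reduction`:
relocation, constants, the `k` tables of the split instance — `hasOrthogonalTuple_splitInstance_iff`
— one emulated run of the `k`-OV program, read-out) at word size `kfit · (n + width)`; the build
costs `O(N (n+1)²) = O(2^{δ n})` as `δ > 1/k` (`Tpre_real_le`, `exists_sq_le_two_rpow`), and the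
emulated run `38 ⌊C N^{k-ε} + C⌋ ≤ 38 C 2^k 2^{(1-ε/k) n} + 38 C = O(2^{δ n})` (`rpow_N_le`).
[cite: VassilevskaWilliamsICM2018, §3 Thm. 3.1 (proof)]
[cite: WilliamsTCS2005, §5.1 Thm. 5.1] -/
theorem sparseKSATInRAMTime_of_kOV_inTimeO_holds : sparseKSATInRAMTime_of_kOV_inTimeO := by
  classical
  intro k hk ε hε hε1 hOV k' c' δ hδ
  have hk1 : 1 ≤ k := by omega
  set c : ℕ := c' * k + 1 with hcdef
  have hc1 : 1 ≤ c := by omega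
  obtain ⟨C, M, kM, hdet, hof, hM⟩ := hOV c hc1
  -- real constants
  have hk0 : (0 : ℝ) < k := by exact_mod_cast (show 0 < k by omega)
  have hk2 : (2 : ℝ) ≤ k := by exact_mod_cast hk
  have hεk : ε ≤ (k : ℝ) := by linarith
  have hquot : 1 - ε / k < δ := hδ
  have h1k : 1 / (k : ℝ) ≤ 1 - ε / k := by
    rw [div_le_iff₀ hk0, sub_mul, div_mul_cancel₀ _ hk0.ne', one_mul]
    nlinarith
  have hη : 0 < δ - 1 / k := by linarith
  obtain ⟨C₃, hC₃, hpoly⟩ := CliqueRed.exists_sq_le_two_rpow hη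
  set cM := M.maxConst with hcM
  set Cp : ℝ := max C 0 with hCp
  have hCp0 : 0 ≤ Cp := le_max_right _ _
  have hCCp : C ≤ Cp := le_max_left _ _
  set Q : ℝ := 392 * ((c : ℝ) * k * (k' + 1) * (c' + 1)) * C₃ with hQ
  have hQ0 : 0 ≤ Q := by positivity
  set CR : ℝ := Q + 38 * (Cp * (2 : ℝ) ^ (k : ℝ) + Cp) + 4 with hCR
  have hCR0 : 0 ≤ CR := by positivity
  refine ⟨KOVRed.reduction M k c kM, KOVRed.Params.kfit k c kM cM, CR,
    KOVRed.reduction_isDeterministic M k c kM, KOVRed.reduction_isOracleFree M k c kM,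
    fun φ hsparse => ?_⟩
  -- one instance
  obtain ⟨hw, -⟩ := φ.2
  set g : KOVRed.Params := ⟨φ.1, k, c, kM, cM⟩ with hgdef
  have hsize : (kSATProblem k').size φ = g.n := rfl
  have hwidth : (kSATProblem k').width φ = inputWidth g.x := rfl
  have henc : (kSATProblem k').encode φ = g.x := rfl
  rw [hsize] at hsparse ⊢
  rw [hwidth, henc]
  have hm : g.m ≤ c' * g.n := hsparse
  have hmd : g.m ≤ g.d := KOVRed.length_le_mul_grpLen (k := k) hk1 hm
  have hF := g.fits hk1 hc1
  -- the `k`-OV program on the split instance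
  set I : (kOVWithDim k c).Inst := ⟨KOVRed.splitInstance φ.1 k c, KOVRed.splitInstance_mem φ.1 k c⟩ with hI
  obtain ⟨out, hout, hMrun⟩ := hM I
  change out ∈ (kOV k).Good (KOVRed.splitInstance φ.1 k c) at hout
  rw [KOVRed.kOV_good_splitInstance hk1 hmd, Set.mem_singleton_iff] at hout
  subst hout
  have hLy' : 2 + k * ((KOVRed.splitInstance φ.1 k c).n * (KOVRed.splitInstance φ.1 k c).d) =
      g.Ly := by
    show 2 + k * (g.N * g.d) = g.N * g.d * g.k + 2; ring
  change OutputsWithin M (kM * (kOV k).width (KOVRed.splitInstance φ.1 k c)) noOracle zeroCoins g.y _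
    ⌊C * ((g.N : ℕ) : ℝ) ^ ((k : ℝ) - ε) + C⌋₊ at hMrun
  rw [KOVRed.kOV_width_splitInstance _ hk1 hc1, hLy'] at hMrun
  have hred := g.reduction_outputsWithin hF hk1 hc1 hw hmd hdet hof rfl hMrun
  refine ⟨_, (OVRed.kSATProblem_good_iff k' φ _).2 rfl, hred.mono ?_⟩
  -- the time bound
  set n := g.n with hn
  apply Nat.le_floor
  have hn0 : (0 : ℝ) ≤ n := Nat.cast_nonneg _
  have hδ0 : 0 < δ := by
    have : 0 < 1 / (k : ℝ) := one_div_pos.2 hk0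
    linarith
  have hpos : (0 : ℝ) < (2 : ℝ) ^ (δ * n) := by positivity
  have hone : (1 : ℝ) ≤ (2 : ℝ) ^ (δ * n) := Real.one_le_rpow one_le_two (by positivity)
  -- the build
  have hTpre : (g.Tpre k' : ℝ) ≤ Q * (2 : ℝ) ^ (δ * n) := by
    have h := g.Tpre_real_le hk1 hc1 hw hm (η := δ - 1 / k) hpoly
    have hexp : (2 : ℝ) ^ ((n : ℝ) / k) * (2 : ℝ) ^ ((δ - 1 / k) * n) = (2 : ℝ) ^ (δ * n) := by
      rw [← Real.rpow_add (by norm_num)]; congr 1; field_simp; ring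
    rw [hexp] at h
    exact h
  -- the emulated run
  have hNpow : ((g.N : ℕ) : ℝ) ^ ((k : ℝ) - ε) ≤ (2 : ℝ) ^ (k : ℝ) * (2 : ℝ) ^ (δ * n) := by
    have h := g.rpow_N_le hk1 hε.le hεk
    have h2 : (2 : ℝ) ^ ((1 - ε / k) * (n : ℝ)) ≤ (2 : ℝ) ^ (δ * n) :=
      Real.rpow_le_rpow_of_exponent_le one_le_two (by nlinarith)
    calc ((g.N : ℕ) : ℝ) ^ ((k : ℝ) - ε) ≤ (2 : ℝ) ^ (k : ℝ) * (2 : ℝ) ^ ((1 - ε / k) * (n : ℝ)) := h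
      _ ≤ (2 : ℝ) ^ (k : ℝ) * (2 : ℝ) ^ (δ * n) := by gcongr
  have hT : ((⌊C * ((g.N : ℕ) : ℝ) ^ ((k : ℝ) - ε) + C⌋₊ : ℕ) : ℝ) ≤
      Cp * ((2 : ℝ) ^ (k : ℝ) * (2 : ℝ) ^ (δ * n)) + Cp := by
    refine (KOVRed.natFloor_le_max _).trans (max_le ?_ (by positivity))
    have hNn : (0 : ℝ) ≤ ((g.N : ℕ) : ℝ) ^ ((k : ℝ) - ε) := by positivity
    calc C * ((g.N : ℕ) : ℝ) ^ ((k : ℝ) - ε) + C ≤ Cp * ((g.N : ℕ) : ℝ) ^ ((k : ℝ) - ε) + Cp := by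
          gcongr
      _ ≤ Cp * ((2 : ℝ) ^ (k : ℝ) * (2 : ℝ) ^ (δ * n)) + Cp := by gcongr
  unfold KOVRed.Params.Ttotal
  push_cast
  have hcs : (cstep : ℝ) = 38 := by norm_num [cstep]
  rw [hcs]
  calc (g.Tpre k' : ℝ) + 38 * (((⌊C * ((g.N : ℕ) : ℝ) ^ ((k : ℝ) - ε) + C⌋₊ : ℕ) : ℝ)) + 4
      ≤ Q * (2 : ℝ) ^ (δ * n) + 38 * (Cp * ((2 : ℝ) ^ (k : ℝ) * (2 : ℝ) ^ (δ * n)) + Cp) + 4 := by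
        linarith
    _ ≤ Q * (2 : ℝ) ^ (δ * n) + 38 * (Cp * ((2 : ℝ) ^ (k : ℝ) * (2 : ℝ) ^ (δ * n)) +
          Cp * (2 : ℝ) ^ (δ * n)) + 4 * (2 : ℝ) ^ (δ * n) := by nlinarith
    _ = CR * (2 : ℝ) ^ (δ * n) := by rw [hCR]; ring
    _ ≤ CR * (2 : ℝ) ^ (δ * n) + CR := by linarith

/-- **The target reduced to word-RAM sparsification.** With the split-and-list reduction
discharged, `not_kOVWithDim_inTimeO_of_sethWordRAM` (word-RAM SETH ⇒ `k`-OV requires `n^{k-o(1)}`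
in dimension `c log n`; VVW ICM 2018, Thm. 3.1) follows from the SETH-granularity sparsification fact
`kSATInRAMTime_of_sparseKSATInRAMTime_serf` alone. [cite: VassilevskaWilliamsICM2018, §3 Thm. 3.1] -/
theorem not_kOVWithDim_inTimeO_of_sethWordRAM_of_serf
    (hsparse : kSATInRAMTime_of_sparseKSATInRAMTime_serf) : not_kOVWithDim_inTimeO_of_sethWordRAM :=
  not_kOVWithDim_inTimeO_of_sethWordRAM_of hsparse sparseKSATInRAMTime_of_kOV_inTimeO_holds

end Literature.Computability.FineGrained
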